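import Summits.ResolutionOfSingularities.ResolutionOfSingularities.Theorems.HilbertSamuelEliminationSigmaMaxModificationsCorridor3WLadderRationalNearStep
import Literature.AlgebraicGeometry.CossartJannsenSaito2020.BlowupTowerLocalizeDir
import Literature.AlgebraicGeometry.CossartJannsenSaito2020.BlowupTowerLocalizePerm
import Literature.AlgebraicGeometry.Resolution.PermissibleCentres
import HarnessLib

/-!
# [OURS · L1 W4.2] One blow-up read LOCALLY AT A POINT `y` that is a point of the centre «as a whole locally»
# (`Spec 𝒪_{X,y} ∩ C = {y}`, e.g. `y` the generic point of the irreducible centre): the base change to `Spec 𝒪_{X,y}`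
# is the blow-up of the local scheme in its CLOSED point, and everything about the points over `y` transfers
# (campaign s42, cell res-hironaka; P-b of chain w42's RECOGNITION-CUT (R2), crux stmt-ResolutionOfSingularities-18506 /
# conjunct stmt-ResolutionOfSingularities-19249; `--supports`)

HONEST FRAMING. OURS plumbing (slot W4.2, prover res-L1-s42-pv-1, gen 4) over res-type-053's localisation kit
(`BlowupTowerLocalize*`, `DirectrixSchemeLocal`, `BlowupsFlatBaseChange`) and COMPLEMENTING res-L1-w42-stub-2's / lead-1's
local point blow-up files (`…Corridor3WLadderLocalPointBlowup`: `Moving.isBlowup_pullback_snd_fromSpecStalk_singleton`,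
`Moving.exists_lift_pullback_fromSpecStalk`, …; `…Corridor3WLadderRationalNearStep`: `Helpers.charHypothesis_spec_stalk`,
`Helpers.exists_rational_lift_of_near_of_dirDim_eq_one`), which are phrased by `𝓘_{C,y} = 𝔪_y` and never assume `y` closed.
Written for ONE blow-up `π : X' → X` in a closed `C ⊆ X` (reduced structure) and ONE point `y ∈ X` — typically NOT closed —
such that the generizations of `y` meet `C` only in `y`:

  `(X.fromSpecStalk y)⁻¹(C) = {𝔪_y}`                                                            (loc)

(CJS LNM 2270 p. 104: the centre `C_{q−1}` at its generic point `η_{q−1}`; p. 107 «the claims … depend only on the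
localization»). Under (loc):

* `isBlowup_pullback_snd_fromSpecStalk` — `X' ×_X Spec 𝒪_{X,y} → Spec 𝒪_{X,y}` IS the blow-up of the local scheme in its
  closed point (reduced), so the tree's POINT-centre theorems (`projDir_line`, the binder `Thm314_point_locus`, …)
  apply to it;
* `stalkIdeal_vanishingIdeal_eq_maximalIdeal_of_preimage_eq` — `𝓘_{C,y} = 𝔪_y` (the hypothesis under which this
  campaign's ridge/directrix confinement theorems are stated: `…RidgeConfinesOfPermissible`, `…ProjDirectrixOfPerfect`,
  `…ProjDirectrixOfDirDimEq`);
* the points of `X'` over `y` ARE the points of the base change over the closed point (`exists_pullback_fst_eq_of_eq`,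
  `pullback_snd_eq_closedPoint_iff`, injectivity of the projection), with equal Hilbert–Samuel functions, equal
  `ℙ(Dir)`-membership (`isOnProjDirectrix_pullback_iff`) and simultaneous residual rationality
  (`isIso_residueFieldMap_pullback_iff`);
* the local scheme inherits excellence, the dimension bound and permissibility of the point centre
  (`isExcellent_Spec_stalk`, `isPermissible_vanishingIdeal_closedPoint`; (F1) is `Helpers.charHypothesis_spec_stalk`);
* (loc) holds at the generic point of an irreducible closed `C` (`preimage_fromSpecStalk_eq_singleton_of_isGenericPoint`).

NOTHING here is a statement of H. Hironaka's manuscript [Hironaka2017]; no theorem of [CJS 2020] is asserted. AI review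
is weaker than expert review. References (orientation only): V. Cossart, U. Jannsen, S. Saito, LNM 2270 (2020), p. 104,
p. 107, Lemma 2.27; U. Görtz, T. Wedhorn, *Algebraic Geometry I*, Prop. 13.91 (2); Stacks Project Tag 01J7.
-/

noncomputable section

-- single-conjunct summit: the doubled namespace component `ResolutionOfSingularities` is mandated
set_option linter.dupNamespace false

open CategoryTheory CategoryTheory.Limits AlgebraicGeometry TopologicalSpace IsLocalRing
open Literature.AlgebraicGeometry.Resolution Literature.AlgebraicGeometry.CossartJannsenSaito2020
open Literature.RingTheory.HilbertSamuel
open Scheme.IdealSheafData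

namespace Summit.ResolutionOfSingularities.ResolutionOfSingularities.Theorems

namespace CampaignW42

universe u

/-! ## Residue fields along morphisms inducing isomorphisms of local rings -/

/-- A morphism inducing an isomorphism of local rings at `s` induces an isomorphism of residue fields at `s`. [folklore] -/
theorem isIso_residueFieldMap_of_isIso_stalkMap {S X : Scheme.{u}} (f : S ⟶ X) (s : S) [IsIso (f.stalkMap s)] :
    IsIso (f.residueFieldMap s) :=
  (IsLocalRing.ResidueField.mapEquiv (asIso (f.stalkMap s)).commRingCatIsoToRingEquiv).toCommRingCatIso.isIso_hom

/-- **Residual rationality transfers along a square with isomorphic local rings**: for `ι₁ ≫ π = π' ≫ ι₀` with `ι₁`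
an isomorphism on the local ring at `s` and `ι₀` one at `π' s`, `κ(π' s) → κ(s)` is an isomorphism iff
`κ(π(ι₁ s)) → κ(ι₁ s)` is. [folklore] -/
theorem isIso_residueFieldMap_iff_of_isIso_stalkMap {X₁ X S₁ S : Scheme.{u}} {π : X₁ ⟶ X} {π' : S₁ ⟶ S}
    {ι₁ : S₁ ⟶ X₁} {ι₀ : S ⟶ X} (hsq : ι₁ ≫ π = π' ≫ ι₀) (s : S₁) [IsIso (ι₁.stalkMap s)]
    [IsIso (ι₀.stalkMap (π'.base s))] :
    IsIso (π'.residueFieldMap s) ↔ IsIso (π.residueFieldMap (ι₁.base s)) := by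
  have e1 : IsIso (ι₁.residueFieldMap s) := isIso_residueFieldMap_of_isIso_stalkMap ι₁ s
  have e0 : IsIso (ι₀.residueFieldMap (π'.base s)) := isIso_residueFieldMap_of_isIso_stalkMap ι₀ (π'.base s)
  have h1 : (ι₁ ≫ π).residueFieldMap s = π.residueFieldMap (ι₁.base s) ≫ ι₁.residueFieldMap s :=
    Scheme.residueFieldMap_comp _ _ _
  have h2 : (π' ≫ ι₀).residueFieldMap s = ι₀.residueFieldMap (π'.base s) ≫ π'.residueFieldMap s :=
    Scheme.residueFieldMap_comp _ _ _
  have h3 := Scheme.Hom.residueFieldMap_congr hsq s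
  rw [h1, h2] at h3
  -- `π.res ≫ ι₁.res = e ≫ ι₀.res ≫ π'.res` with `ι₁.res`, `e`, `ι₀.res` isomorphisms
  constructor
  · intro h
    have h4 : IsIso (ι₀.residueFieldMap (π'.base s) ≫ π'.residueFieldMap s) := @IsIso.comp_isIso _ _ _ _ _ _ _ e0 h
    have h5 : IsIso (π.residueFieldMap (ι₁.base s) ≫ ι₁.residueFieldMap s) := by
      rw [h3]; exact @IsIso.comp_isIso _ _ _ _ _ _ _ inferInstance h4
    exact @IsIso.of_isIso_comp_right _ _ _ _ _ _ _ e1 h5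
  · intro h
    have h4 : IsIso (π.residueFieldMap (ι₁.base s) ≫ ι₁.residueFieldMap s) := @IsIso.comp_isIso _ _ _ _ _ _ _ h e1
    rw [h3] at h4
    have h5 := @IsIso.of_isIso_comp_left _ _ _ _ _ _ _ inferInstance h4
    exact @IsIso.of_isIso_comp_left _ _ _ _ _ _ _ e0 h5

/-! ## The local scheme `Spec 𝒪_{X,y}`: which points of `C` it sees -/

section LocalScheme

variable {X : Scheme.{u}} (y : X)

/-- The points of `Spec 𝒪_{X,y}` map to generizations of `y`, and only the closed point maps to `y`. [cite: StacksProject, Tag 01J7] -/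
theorem fromSpecStalk_base_eq_iff (s : ↥(Spec (X.presheaf.stalk y))) :
    (X.fromSpecStalk y).base s = y ↔ s = closedPoint (X.presheaf.stalk y) := by
  constructor
  · intro h
    apply (X.fromSpecStalk y).isEmbedding.injective
    rw [h, Scheme.fromSpecStalk_closedPoint]
  · rintro rfl
    exact Scheme.fromSpecStalk_closedPoint

/-- **(loc) characterised**: `(Spec 𝒪_{X,y} → X)⁻¹(C) = {𝔪_y}` iff `y ∈ C` and no proper generization of `y` lies in `C`.
[cite: StacksProject, Tag 01J7] -/
theorem preimage_fromSpecStalk_eq_singleton_iff (C : Set X) :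
    (X.fromSpecStalk y).base ⁻¹' C = {closedPoint (X.presheaf.stalk y)} ↔
      y ∈ C ∧ ∀ y' ∈ C, y' ⤳ y → y' = y := by
  constructor
  · intro h
    have hy : (X.fromSpecStalk y).base (closedPoint (X.presheaf.stalk y)) ∈ C := by
      have h1 : closedPoint (X.presheaf.stalk y) ∈ (X.fromSpecStalk y).base ⁻¹' C := by
        rw [h]; exact rfl
      exact h1
    rw [Scheme.fromSpecStalk_closedPoint] at hy
    refine ⟨hy, fun y' hy' hsp => ?_⟩
    obtain ⟨s, hs⟩ : y' ∈ Set.range (X.fromSpecStalk y).base := by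
      rw [Scheme.range_fromSpecStalk]; exact hsp
    have hsC : s ∈ (X.fromSpecStalk y).base ⁻¹' C := by
      change (X.fromSpecStalk y).base s ∈ C
      rw [hs]; exact hy'
    rw [h] at hsC
    have hsC' : s = closedPoint (X.presheaf.stalk y) := hsC
    rw [← hs, hsC', Scheme.fromSpecStalk_closedPoint]
  · rintro ⟨hyC, hmax⟩
    ext s
    refine ⟨fun hs => ?_, fun hs => ?_⟩
    · show s = closedPoint (X.presheaf.stalk y)
      refine (fromSpecStalk_base_eq_iff y s).mp (hmax _ hs ?_)
      have : (X.fromSpecStalk y).base s ∈ Set.range (X.fromSpecStalk y).base := ⟨s, rfl⟩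
      rw [Scheme.range_fromSpecStalk] at this
      exact this
    · have hs' : s = closedPoint (X.presheaf.stalk y) := hs
      show (X.fromSpecStalk y).base s ∈ C
      rw [hs', Scheme.fromSpecStalk_closedPoint]; exact hyC

/-- **(loc) at a generic point**: if `y` is a generic point of the closed set `C` (`closure {y} = C`), then
`(Spec 𝒪_{X,y} → X)⁻¹(C) = {𝔪_y}` — the centre `C_{q−1}` seen from `𝒪_{X_{q−1}, η_{q−1}}` is the closed point
(CJS p. 104). [cite: CossartJannsenSaito2020, p. 104, p. 107] -/
theorem preimage_fromSpecStalk_eq_singleton_of_isGenericPoint {C : Set X} (hy : IsGenericPoint y C) :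
    (X.fromSpecStalk y).base ⁻¹' C = {closedPoint (X.presheaf.stalk y)} := by
  rw [preimage_fromSpecStalk_eq_singleton_iff]
  refine ⟨hy.mem, fun y' hy' hsp => ?_⟩
  have h1 : y ⤳ y' := hy.specializes hy'
  exact (hsp.antisymm h1).eq


/-- The local scheme of an excellent scheme is excellent (Matsumura §32; kit `isExcellentRing_stalk_of_isExcellent`).
[cite: Matsumura1987, §32 p. 260] -/
theorem isExcellent_Spec_stalk (hX : Scheme.IsExcellent X) : Scheme.IsExcellent (Spec (X.presheaf.stalk y)) :=
  Scheme.isExcellent_Spec_of_isExcellentRing _ (isExcellentRing_stalk_of_isExcellent hX y)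

/-- `dim Spec 𝒪_{X,y} ≤ dim X` (`Spec 𝒪_{X,y} → X` is a topological embedding). [cite: StacksProject, Tag 01J7] -/
theorem topologicalKrullDim_Spec_stalk_le :
    topologicalKrullDim ↥(Spec (X.presheaf.stalk y)) ≤ topologicalKrullDim ↥X :=
  (X.fromSpecStalk y).isEmbedding.isInducing.topologicalKrullDim_le

/-- **The closed point of `Spec 𝒪_{X,y}` is a permissible centre as soon as `dim 𝒪_{X,y} > 0`** (a reduced point is
regular, and every scheme is normally flat along a reduced point; the tree's `isPermissible_maximalIdeal_iff` excludes
only the case where `𝔪_y` is a minimal prime). [cite: CossartJannsenSaito2020, Def. 3.1] -/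
theorem isPermissible_vanishingIdeal_closedPoint (hpos : 0 < ringKrullDim (X.presheaf.stalk y)) :
    IdealSheafData.IsPermissible
      (vanishingIdeal (⟨{closedPoint (X.presheaf.stalk y)},
        (PrimeSpectrum.isClosed_singleton_iff_isMaximal _).mpr (inferInstanceAs (maximalIdeal (X.presheaf.stalk y)).IsMaximal)⟩ :
          Closeds ↥(Spec (X.presheaf.stalk y)))) := by
  have hcl : IsClosed ({closedPoint (X.presheaf.stalk y)} : Set ↥(Spec (X.presheaf.stalk y))) :=
    (PrimeSpectrum.isClosed_singleton_iff_isMaximal _).mpr (inferInstanceAs (maximalIdeal (X.presheaf.stalk y)).IsMaximal)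
  intro s hs
  have hs' : s = closedPoint (X.presheaf.stalk y) := by
    rw [← SetLike.mem_coe, Scheme.IdealSheafData.coe_support_vanishingIdeal] at hs
    exact hs
  subst hs'
  have h2 := stalkIdeal_vanishingIdeal_singleton hcl
  rw [IdealSheafData.isPermissibleAt_iff]
  refine Eq.mpr (congrArg Ideal.IsPermissible h2) ?_
  refine (isPermissible_maximalIdeal_iff _).mpr fun hmin => ?_
  have h0 : (maximalIdeal ((Spec (X.presheaf.stalk y)).presheaf.stalk (closedPoint (X.presheaf.stalk y)))).height = 0 :=
    Ideal.height_eq_zero_iff.mpr hmin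
  have hdim : ringKrullDim ((Spec (X.presheaf.stalk y)).presheaf.stalk (closedPoint (X.presheaf.stalk y))) = 0 := by
    rw [← IsLocalRing.maximalIdeal_height_eq_ringKrullDim, h0]; rfl
  haveI := isIso_stalkMap_fromSpecStalk X y (closedPoint (X.presheaf.stalk y))
  have e := (asIso ((X.fromSpecStalk y).stalkMap (closedPoint (X.presheaf.stalk y)))).commRingCatIsoToRingEquiv
  have hdim' : ringKrullDim (X.presheaf.stalk ((X.fromSpecStalk y).base (closedPoint (X.presheaf.stalk y)))) = 0 := by
    rw [ringKrullDim_eq_of_ringEquiv e, hdim]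
  rw [Scheme.fromSpecStalk_closedPoint] at hdim'
  rw [hdim'] at hpos
  exact lt_irrefl _ hpos

end LocalScheme

/-! ## One blow-up, base-changed to `Spec 𝒪_{X,y}` -/

section OneBlowup

variable {X X' : Scheme.{u}} [IsLocallyNoetherian X] (π : X' ⟶ X) (y : X)

omit [IsLocallyNoetherian X] in
/-- **Under (loc), the base change of the blow-up of `C` to `Spec 𝒪_{X,y}` is the blow-up of the local scheme in its
CLOSED point** (blow-ups commute with flat base change, GW 13.91 (2), tree `IsBlowup.pullback_snd_of_flat`; the reduced
ideal of `C` pulls back to the reduced ideal of `ι⁻¹ C = {𝔪_y}`, kit `comap_vanishingIdeal_eq_of_flat_of_isPreimmersion`).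
[cite: GortzWedhorn2020, Prop. 13.91 (2)] [cite: CossartJannsenSaito2020, p. 107] -/
theorem isBlowup_pullback_snd_fromSpecStalk {C : Closeds X} (hπ : IsBlowup π (vanishingIdeal C))
    (hCy : (X.fromSpecStalk y).base ⁻¹' (C : Set X) = {closedPoint (X.presheaf.stalk y)})
    (hcl : IsClosed ({closedPoint (X.presheaf.stalk y)} : Set ↥(Spec (X.presheaf.stalk y)))) :
    IsBlowup (pullback.snd π (X.fromSpecStalk y))
      (vanishingIdeal (⟨{closedPoint (X.presheaf.stalk y)}, hcl⟩ : Closeds ↥(Spec (X.presheaf.stalk y)))) := by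
  haveI := flat_fromSpecStalk X y
  have h := hπ.pullback_snd_of_flat (X.fromSpecStalk y)
  rw [comap_vanishingIdeal_eq_of_flat_of_isPreimmersion] at h
  have hC : C.preimage (X.fromSpecStalk y).continuous =
      (⟨{closedPoint (X.presheaf.stalk y)}, hcl⟩ : Closeds ↥(Spec (X.presheaf.stalk y))) :=
    Closeds.ext hCy
  rwa [hC] at h

omit [IsLocallyNoetherian X] in
/-- **Under (loc), `𝓘_{C,y} = 𝔪_y`**: the stalk at `y` of the reduced ideal of `C` is the maximal ideal (read through the
isomorphism `𝒪_{X,y} ≅ 𝒪_{Spec 𝒪_{X,y}, 𝔪_y}` and `stalkIdeal_vanishingIdeal_singleton` on the local scheme).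
[cite: CossartJannsenSaito2020, p. 107] -/
theorem stalkIdeal_vanishingIdeal_eq_maximalIdeal_of_preimage_eq {C : Closeds X}
    (hCy : (X.fromSpecStalk y).base ⁻¹' (C : Set X) = {closedPoint (X.presheaf.stalk y)}) :
    stalkIdeal (vanishingIdeal C) y = maximalIdeal (X.presheaf.stalk y) := by
  haveI := flat_fromSpecStalk X y
  have hcl : IsClosed ({closedPoint (X.presheaf.stalk y)} : Set ↥(Spec (X.presheaf.stalk y))) :=
    (PrimeSpectrum.isClosed_singleton_iff_isMaximal _).mpr (inferInstanceAs (maximalIdeal (X.presheaf.stalk y)).IsMaximal)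
  have hC : (vanishingIdeal C).comap (X.fromSpecStalk y) =
      vanishingIdeal (⟨{closedPoint (X.presheaf.stalk y)}, hcl⟩ : Closeds ↥(Spec (X.presheaf.stalk y))) := by
    rw [comap_vanishingIdeal_eq_of_flat_of_isPreimmersion]
    exact congrArg _ (Closeds.ext hCy)
  -- at the closed point: `𝓘·𝒪 = 𝔪`, i.e. `(stalkIdeal (vI C) (ι 𝔪_y)).map ι^♯ = 𝔪`
  have h1 : maximalIdeal ((Spec (X.presheaf.stalk y)).presheaf.stalk (closedPoint (X.presheaf.stalk y))) =
      (stalkIdeal (vanishingIdeal C) ((X.fromSpecStalk y).base (closedPoint (X.presheaf.stalk y)))).map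
        ((X.fromSpecStalk y).stalkMap (closedPoint (X.presheaf.stalk y))).hom := by
    rw [← stalkIdeal_comap_eq_map_stalkMap, hC]
    exact (stalkIdeal_vanishingIdeal_singleton hcl).symm
  -- transport along the point equality `ι 𝔪_y = y` and the stalk isomorphism
  have key : ∀ z : X, z = (X.fromSpecStalk y).base (closedPoint (X.presheaf.stalk y)) →
      stalkIdeal (vanishingIdeal C) z = maximalIdeal (X.presheaf.stalk z) := by
    rintro z rfl
    haveI := isIso_stalkMap_fromSpecStalk X y (closedPoint (X.presheaf.stalk y))
    set φ := ((X.fromSpecStalk y).stalkMap (closedPoint (X.presheaf.stalk y))).hom with hφ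
    haveI : IsLocalHom φ := (X.fromSpecStalk y).toLRSHom.prop _
    let e := (asIso ((X.fromSpecStalk y).stalkMap (closedPoint (X.presheaf.stalk y)))).commRingCatIsoToRingEquiv
    have hbij : Function.Bijective φ := e.bijective
    apply le_antisymm
    · intro a ha
      have h2 : φ a ∈ maximalIdeal _ := by rw [h1]; exact Ideal.mem_map_of_mem φ ha
      rw [mem_maximalIdeal, mem_nonunits_iff] at h2 ⊢
      exact fun hu => h2 (hu.map φ)
    · intro a ha
      have h2 : φ a ∈ (stalkIdeal (vanishingIdeal C) ((X.fromSpecStalk y).base (closedPoint (X.presheaf.stalk y)))).map φ := by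
        rw [← h1]
        exact map_nonunit φ a ha
      obtain ⟨a', ha', h3⟩ := (Ideal.mem_map_iff_of_surjective φ hbij.2).mp h2
      rwa [← hbij.1 h3]
  exact (key y Scheme.fromSpecStalk_closedPoint.symm)

omit [IsLocallyNoetherian X] in
/-- **Every point of `X'` over `y` comes from the base change**, from a point over the closed point (a fibre product
of schemes surjects onto the fibre product of sets). [cite: StacksProject, Tag 01J7] -/
theorem exists_pullback_fst_eq_of_eq {x' : X'} (hx' : π.base x' = y) :
    ∃ s : ↥(pullback π (X.fromSpecStalk y)), (pullback.fst π (X.fromSpecStalk y)).base s = x' ∧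
      (pullback.snd π (X.fromSpecStalk y)).base s = closedPoint (X.presheaf.stalk y) :=
  Scheme.Pullback.exists_preimage_pullback (f := π) (g := X.fromSpecStalk y) x' (closedPoint (X.presheaf.stalk y))
    (hx'.trans Scheme.fromSpecStalk_closedPoint.symm)

omit [IsLocallyNoetherian X] in
/-- The projection `X' ×_X Spec 𝒪_{X,y} → X'` is injective on points (a base change of the preimmersion
`Spec 𝒪_{X,y} → X`). [cite: StacksProject, Tag 01J7] -/
theorem pullback_fst_fromSpecStalk_injective : Function.Injective (pullback.fst π (X.fromSpecStalk y)).base :=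
  (pullback.fst π (X.fromSpecStalk y)).isEmbedding.injective

omit [IsLocallyNoetherian X] in
/-- A point of the base change lies over the closed point iff its image in `X'` lies over `y`. [cite: StacksProject, Tag 01J7] -/
theorem pullback_snd_eq_closedPoint_iff (s : ↥(pullback π (X.fromSpecStalk y))) :
    (pullback.snd π (X.fromSpecStalk y)).base s = closedPoint (X.presheaf.stalk y) ↔
      π.base ((pullback.fst π (X.fromSpecStalk y)).base s) = y := by
  have hsq : π.base ((pullback.fst π (X.fromSpecStalk y)).base s) =
      (X.fromSpecStalk y).base ((pullback.snd π (X.fromSpecStalk y)).base s) := by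
    change (pullback.fst π (X.fromSpecStalk y) ≫ π).base s = (pullback.snd π (X.fromSpecStalk y) ≫ X.fromSpecStalk y).base s
    rw [pullback.condition]
  rw [hsq, fromSpecStalk_base_eq_iff]

/-- **Nearness transfers**: a point of the base change over the closed point is near to it iff its image in `X'` is near
to `y` (equal Hilbert–Samuel functions along the isomorphisms of local rings, CJS Lemma 2.27 / p. 107).
[cite: CossartJannsenSaito2020, Lemma 2.27 (1), p. 107] -/
theorem hsFun_pullback_eq_iff [IsLocallyNoetherian X'] (N : ℕ) (s : ↥(pullback π (X.fromSpecStalk y))) :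
    Scheme.hsFun (pullback π (X.fromSpecStalk y)) N s =
        Scheme.hsFun (Spec (X.presheaf.stalk y)) N (closedPoint (X.presheaf.stalk y)) ↔
      Scheme.hsFun X' N ((pullback.fst π (X.fromSpecStalk y)).base s) = Scheme.hsFun X N y := by
  rw [Scheme.hsFun_pullback_fst_fromSpecStalk π y N s, Scheme.hsFun_fromSpecStalk_closedPoint]

/-- **`ℙ(Dir)`-membership transfers**: `s ∈ ℙ(Dir)` for the base-changed blow-up iff its image is on `ℙ(Dir_y(X))` for `π`
(kit `isOnProjDirectrix_iff_of_isIso_stalkMap`). [cite: CossartJannsenSaito2020, Def. 6.34 (i), p. 107] -/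
theorem isOnProjDirectrix_pullback_iff (s : ↥(pullback π (X.fromSpecStalk y))) :
    IsOnProjDirectrix (pullback.snd π (X.fromSpecStalk y)) s ↔
      IsOnProjDirectrix π ((pullback.fst π (X.fromSpecStalk y)).base s) := by
  haveI := isIso_stalkMap_pullback_fst_fromSpecStalk π y s
  haveI := isIso_stalkMap_fromSpecStalk X y ((pullback.snd π (X.fromSpecStalk y)).base s)
  exact isOnProjDirectrix_iff_of_isIso_stalkMap pullback.condition s

omit [IsLocallyNoetherian X] in
/-- **Residual rationality transfers**: `κ(𝔪_y) → κ(s)` is an isomorphism for the base-changed blow-up iff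
`κ(π x') → κ(x')` is for the image point `x'` of `s`. [cite: CossartJannsenSaito2020, p. 107] -/
theorem isIso_residueFieldMap_pullback_iff (s : ↥(pullback π (X.fromSpecStalk y))) :
    IsIso ((pullback.snd π (X.fromSpecStalk y)).residueFieldMap s) ↔
      IsIso (π.residueFieldMap ((pullback.fst π (X.fromSpecStalk y)).base s)) := by
  haveI := isIso_stalkMap_pullback_fst_fromSpecStalk π y s
  haveI := isIso_stalkMap_fromSpecStalk X y ((pullback.snd π (X.fromSpecStalk y)).base s)
  exact isIso_residueFieldMap_iff_of_isIso_stalkMap pullback.condition s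

end OneBlowup

end CampaignW42

end Summit.ResolutionOfSingularities.ResolutionOfSingularities.Theorems

end
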